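import Literature.Geometry.Lorentzian.RelativeDevelopmentGluingCauchy
import Literature.Geometry.Lorentzian.SubdevelopmentCausalConvexity
import HarnessLib

/-!
# Causality of a relative common development: `ψ` and `ψ⁻¹` transport the chronological
# relation, and `ι₂(Φ N)` is a Cauchy hypersurface of `ψ(U)`

Let `𝔠 = (U ⊆ M₁, ψ : U → M₂)` be a relative common development of a Cauchy development `𝒟₁`
of data `D₁` on `N` and a Cauchy development `𝒟₂` of data `D₂` on `X` over `Φ : N → X`
(`CauchyDevelopment.RelCommonDevelopment`, file `RelativeDevelopmentGluingData`: `ι₁(N) ⊆ U` is a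
Cauchy hypersurface of the open sub-spacetime `U`, `ψ` an injective time-orientation preserving
isometric immersion with `ψ ∘ ι₁ = ι₂ ∘ Φ`). This file records the elementary causality of this
configuration, in the form used by the localisation argument of Hawking–Ellis 1973, §7.6 and by
the relative version of Sbierski's "no corresponding boundary points" theorem (2016, §3.2):

* `ψ(U)` as an open sub-spacetime `rangeOpens` of `M₂`, the inverse `ψ⁻¹ = glue.symm` on it
  (smooth, isometric, reflecting future-directedness: `contMDiffAt_glue_symm`,
  `val_mfderiv_glue_symm'`, `isFutureDirected_mfderiv_glue_symm` — the relative forms of the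
  lemmas of `CommonDevelopmentSymm`);
* **`ψ` carries timelike segments of `M₁` inside `U` to timelike segments of `M₂`**
  (`mem_chronologicalFuture_glue_of_curve`) and **`ψ⁻¹` carries timelike segments of `M₂` inside
  `ψ(U)` back** (`mem_chronologicalFuture_of_curve_in_range`);
* **`ι₂(Φ N) = ψ(ι₁ N)` is a Cauchy hypersurface of `ψ(U)`** (`isCauchyHypersurface_rangeOpens`;
  together with `coe_mem_range_embed_of_map_mem` of `RelativeDevelopmentGluingCauchy`,
  `ψ(U) ∩ ι₂(X) = ι₂(Φ N)`, so that the "no timelike entry" and causal-convexity lemmas of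
  `SubdevelopmentTimelikeEntry` / `SubdevelopmentCausalConvexity` apply to `ψ(U) ⊆ M₂` with the
  Cauchy hypersurface `ι₂(X)` of `M₂`: `range_glue_inter_range_embed`,
  `isCauchyHypersurface_rangeOpens'`);
* `ψ(U)` does not meet `I±(ι₂(X) ∖ ι₂(Φ N))` nor `ι₂(X) ∖ ι₂(Φ N)`
  (`disjoint_range_map_badSet`): the first step of "the image of a relative common development
  lies in the domain of dependence of the sub-datum".

Everything is proved; no named facts. Sources: J. Sbierski, Ann. Henri Poincaré 17 (2016) =
arXiv:1309.7591v3, §2 Remark 3, §3.1 Lemma 9, §3.2; S. W. Hawking, G. F. R. Ellis, *The large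
scale structure of space-time* (1973), §6.5, §7.6; B. O'Neill, *Semi-Riemannian geometry* (1983),
Ch. 3 pp. 90–91, Ch. 14 Def. 14.28, Lemma 14.29.
-/

noncomputable section

open Bundle Set Function Filter TopologicalSpace Topology Manifold
open scoped Manifold ContDiff Topology

namespace Literature.Geometry.Lorentzian

universe u

variable {n : ℕ} {N : Type u} [TopologicalSpace N] [ChartedSpace (EuclideanSpace ℝ (Fin n)) N]
  [IsManifold (𝓡 n) ∞ N] [ConnectedSpace N] {D₁ : InitialDataSet (𝓡 n) N}
  {X : Type u} [TopologicalSpace X] [ChartedSpace (EuclideanSpace ℝ (Fin n)) X]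
  [IsManifold (𝓡 n) ∞ X] [ConnectedSpace X] {D₂ : InitialDataSet (𝓡 n) X}

namespace CauchyDevelopment.RelCommonDevelopment

variable {𝒟₁ : CauchyDevelopment D₁} {𝒟₂ : CauchyDevelopment D₂} {Φ : N → X}
  (𝔠 : RelCommonDevelopment 𝒟₁ 𝒟₂ Φ)

/-! ### `ψ(U)` and `ψ⁻¹` -/

/-- **`ψ(U)` as an open subset of `M₂`** (`ψ` is an open embedding). [cite: Sbierski2016AHP, §3.1, Lemma 9 (arXiv numbering)] -/
def rangeOpens : Opens 𝒟₂.carrier :=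
  ⟨range 𝔠.map, 𝔠.isOpenEmbedding_map.isOpen_range⟩

/-- The carrier of `rangeOpens` is `ψ(U)`. [folklore] -/
@[simp]
theorem coe_rangeOpens : (𝔠.rangeOpens : Set 𝒟₂.carrier) = range 𝔠.map := rfl

/-- Membership in `rangeOpens`. [folklore] -/
theorem mem_rangeOpens_iff {z : 𝒟₂.carrier} : z ∈ 𝔠.rangeOpens ↔ z ∈ range 𝔠.map := Iff.rfl

/-- On `U` the gluing map takes values in `ψ(U)`. [folklore] -/
theorem glue_mem_range {p : 𝒟₁.carrier} (hp : p ∈ 𝔠.opens) : 𝔠.glue p ∈ range 𝔠.map := by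
  rw [𝔠.glue_apply hp]
  exact ⟨_, rfl⟩

/-- `ψ(ι₁ x) = ι₂(Φ x)` for the gluing map. [cite: Sbierski2016AHP, §2, Def. 2.3–2.4 (arXiv: Def. 3–4)] -/
theorem glue_embed (x : N) : 𝔠.glue (𝒟₁.embed x) = 𝒟₂.embed (Φ x) := by
  rw [𝔠.glue_apply (𝔠.embed_mem x)]
  exact 𝔠.map_embedOpens x

/-- The gluing map is continuous on `U`. [folklore] -/
theorem continuousOn_glue : ContinuousOn 𝔠.glue (𝔠.opens : Set 𝒟₁.carrier) := by
  rw [← glue_source]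
  exact 𝔠.glue.continuousOn

/-- The gluing map is a differentiable open partial homeomorphism. [folklore] -/
theorem mdifferentiable_glue : 𝔠.glue.MDifferentiable (𝓡 (n + 1)) (𝓡 (n + 1)) :=
  ⟨𝔠.contMDiffOn_glue.mdifferentiableOn (by simp), 𝔠.contMDiffOn_glue_symm.mdifferentiableOn (by simp)⟩

/-- `ψ⁻¹(z) ∈ U` for `z ∈ ψ(U)`. [folklore] -/
theorem glue_symm_mem_opens {z : 𝒟₂.carrier} (hz : z ∈ range 𝔠.map) : 𝔠.glue.symm z ∈ 𝔠.opens := by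
  have h := 𝔠.glue.map_target (x := z) (by rw [glue_target]; exact hz)
  rwa [glue_source] at h

/-- `ψ (ψ⁻¹ z) = z` for `z ∈ ψ(U)`. [folklore] -/
theorem map_glue_symm {z : 𝒟₂.carrier} (hz : z ∈ range 𝔠.map) :
    𝔠.map ⟨𝔠.glue.symm z, 𝔠.glue_symm_mem_opens hz⟩ = z := by
  rw [← 𝔠.glue_apply]
  exact 𝔠.glue.right_inv (by rw [glue_target]; exact hz)

/-- `glue (glue.symm z) = z` for `z ∈ ψ(U)`. [folklore] -/
theorem glue_glue_symm {z : 𝒟₂.carrier} (hz : z ∈ range 𝔠.map) : 𝔠.glue (𝔠.glue.symm z) = z :=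
  𝔠.glue.right_inv (by rw [glue_target]; exact hz)

/-- The inverse gluing map is smooth at the points of `ψ(U)`. [folklore] -/
theorem contMDiffAt_glue_symm {z : 𝒟₂.carrier} (hz : z ∈ range 𝔠.map) :
    ContMDiffAt (𝓡 (n + 1)) (𝓡 (n + 1)) ∞ 𝔠.glue.symm z :=
  𝔠.contMDiffOn_glue_symm.contMDiffAt (𝔠.glue.open_target.mem_nhds (by rw [glue_target]; exact hz))

/-- **`dψ ∘ dψ⁻¹ = id`** at `ψ y`. [folklore] -/
theorem mfderiv_map_mfderiv_glue_symm (y : 𝔠.opens)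
    (u : TangentSpace (𝓡 (n + 1)) (𝔠.map y)) :
    mfderiv (𝓡 (n + 1)) (𝓡 (n + 1)) 𝔠.map y
      (mfderiv (𝓡 (n + 1)) (𝓡 (n + 1)) 𝔠.glue.symm (𝔠.map y) u) = u := by
  have h := 𝔠.mdifferentiable_glue.comp_symm_deriv (x := 𝔠.map y)
    (by rw [glue_target]; exact ⟨y, rfl⟩)
  have h' : mfderiv (𝓡 (n + 1)) (𝓡 (n + 1)) 𝔠.glue (𝔠.glue.symm (𝔠.map y))
      (mfderiv (𝓡 (n + 1)) (𝓡 (n + 1)) 𝔠.glue.symm (𝔠.map y) u) = u :=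
    DFunLike.congr_fun h u
  have hpt : 𝔠.glue.symm (𝔠.map y) = y := 𝔠.glue_symm_apply_map y
  have hgen : ∀ p : 𝒟₁.carrier, p = (y : 𝒟₁.carrier) →
      mfderiv (𝓡 (n + 1)) (𝓡 (n + 1)) 𝔠.glue p
        (mfderiv (𝓡 (n + 1)) (𝓡 (n + 1)) 𝔠.glue.symm (𝔠.map y) u) = u →
      mfderiv (𝓡 (n + 1)) (𝓡 (n + 1)) 𝔠.map y
        (mfderiv (𝓡 (n + 1)) (𝓡 (n + 1)) 𝔠.glue.symm (𝔠.map y) u) = u := by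
    rintro p rfl hp
    rwa [𝔠.mfderiv_glue_eq] at hp
  exact hgen _ hpt h'

/-- **`ψ⁻¹` is isometric**: `g₁(dψ⁻¹ u, dψ⁻¹ w) = g₂(u, w)` at `ψ y`. O'Neill 1983, Ch. 3, p. 58
(the inverse of an isometry). [cite: ONeillSemiRiemannian1983, Ch. 3, p. 58] -/
theorem val_mfderiv_glue_symm (y : 𝔠.opens) (u w : TangentSpace (𝓡 (n + 1)) (𝔠.map y)) :
    𝒟₁.metric.val y (mfderiv (𝓡 (n + 1)) (𝓡 (n + 1)) 𝔠.glue.symm (𝔠.map y) u)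
        (mfderiv (𝓡 (n + 1)) (𝓡 (n + 1)) 𝔠.glue.symm (𝔠.map y) w) =
      𝒟₂.metric.val (𝔠.map y) u w := by
  have key : ∀ a b : TangentSpace (𝓡 (n + 1)) y,
      𝒟₂.metric.val (𝔠.map y) (mfderiv (𝓡 (n + 1)) (𝓡 (n + 1)) 𝔠.map y a)
        (mfderiv (𝓡 (n + 1)) (𝓡 (n + 1)) 𝔠.map y b) = 𝒟₁.metric.val y a b := fun a b ↦ by
    exact congrArg (fun β ↦ β a b) (𝔠.isIsometricImmersion.2 y)
  rw [← key, mfderiv_map_mfderiv_glue_symm, mfderiv_map_mfderiv_glue_symm]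

/-- The same at a general point `z ∈ ψ(U)`. [cite: ONeillSemiRiemannian1983, Ch. 3, p. 58] -/
theorem val_mfderiv_glue_symm' {z : 𝒟₂.carrier} (hz : z ∈ range 𝔠.map)
    (u w : TangentSpace (𝓡 (n + 1)) z) :
    𝒟₁.metric.val (𝔠.glue.symm z) (mfderiv (𝓡 (n + 1)) (𝓡 (n + 1)) 𝔠.glue.symm z u)
        (mfderiv (𝓡 (n + 1)) (𝓡 (n + 1)) 𝔠.glue.symm z w) = 𝒟₂.metric.val z u w := by
  obtain ⟨y, rfl⟩ := hz
  have hpt : 𝔠.glue.symm (𝔠.map y) = y := 𝔠.glue_symm_apply_map y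
  have hgen : ∀ p : 𝒟₁.carrier, p = (y : 𝒟₁.carrier) →
      𝒟₁.metric.val p (mfderiv (𝓡 (n + 1)) (𝓡 (n + 1)) 𝔠.glue.symm (𝔠.map y) u)
        (mfderiv (𝓡 (n + 1)) (𝓡 (n + 1)) 𝔠.glue.symm (𝔠.map y) w) =
      𝒟₂.metric.val (𝔠.map y) u w := by
    rintro p rfl
    exact 𝔠.val_mfderiv_glue_symm y u w
  exact hgen _ hpt

/-- **`ψ⁻¹` reflects future-directedness**: if `u` is future-directed at `z = ψ y` then `dψ⁻¹ u`
is future-directed at `y` (converse timecone lemma). O'Neill 1983, Ch. 5, p. 145.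
[cite: ONeillSemiRiemannian1983, Ch. 5, p. 145] -/
theorem isFutureDirected_mfderiv_glue_symm {z : 𝒟₂.carrier} (hz : z ∈ range 𝔠.map)
    {u : TangentSpace (𝓡 (n + 1)) z} (hu : 𝒟₂.timeOrientation.IsFutureDirected u) :
    𝒟₁.timeOrientation.IsFutureDirected (x := 𝔠.glue.symm z)
      (mfderiv (𝓡 (n + 1)) (𝓡 (n + 1)) 𝔠.glue.symm z u) := by
  obtain ⟨y, rfl⟩ := hz
  have hpt : 𝔠.glue.symm (𝔠.map y) = y := 𝔠.glue_symm_apply_map y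
  have h : (𝒟₁.timeOrientation.restrict PseudoRiemannianMetric.contMDiff_restrict_holds
      𝒟₁.timeOrientation.contMDiff_restrict_holds 𝔠.opens).IsFutureDirected (x := y)
      (mfderiv (𝓡 (n + 1)) (𝓡 (n + 1)) 𝔠.glue.symm (𝔠.map y) u) :=
    TimeOrientation.PreservesTimeOrientation.isFutureDirected_of_mfderiv 𝔠.preservesTimeOrientation
      𝔠.isIsometricImmersion.2 (by rw [mfderiv_map_mfderiv_glue_symm]; exact hu)
  have hgen : ∀ p : 𝒟₁.carrier, p = (y : 𝒟₁.carrier) →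
      𝒟₁.timeOrientation.IsFutureDirected (x := p)
        (mfderiv (𝓡 (n + 1)) (𝓡 (n + 1)) 𝔠.glue.symm (𝔠.map y) u) := by
    rintro p rfl
    exact h
  exact hgen _ hpt

/-! ### `ψ` and `ψ⁻¹` transport timelike segments -/

/-- **`ψ` carries a timelike segment of `M₁` lying in `U` to a timelike segment of `M₂`**: if
`γ : [a, b] → U ⊆ M₁`, `a < b`, is a future timelike curve of `M₁`, then `ψ (γ b) ∈ I⁺(ψ (γ a))`
in `M₂` (the segment, read in the open sub-spacetime `U`, is pushed forward along the
time-orientation preserving isometric immersion `ψ`). O'Neill 1983, Ch. 3, pp. 90–91 and Ch. 14,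
p. 402. [cite: ONeillSemiRiemannian1983, Ch. 14, p. 402] -/
theorem mem_chronologicalFuture_glue_of_curve {γ : ℝ → 𝒟₁.carrier} {a b : ℝ} (hab : a < b)
    (hγ : 𝒟₁.metric.IsFutureTimelikeCurveOn 𝒟₁.timeOrientation γ (Icc a b))
    (hγU : ∀ t ∈ Icc a b, γ t ∈ 𝔠.opens) :
    𝔠.glue (γ b) ∈ 𝒟₂.metric.chronologicalFuture 𝒟₂.timeOrientation {𝔠.glue (γ a)} := by
  classical
  have ha : a ∈ Icc a b := left_mem_Icc.2 hab.le
  have hb : b ∈ Icc a b := right_mem_Icc.2 hab.le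
  have hcont : ∀ t ∈ Icc a b, ContinuousAt γ t := fun t ht ↦ (hγ t ht).1.continuousAt
  -- the segment as a curve of the open sub-spacetime `U`
  set δ : ℝ → 𝔠.opens := fun t ↦ if h : γ t ∈ 𝔠.opens then ⟨γ t, h⟩ else ⟨γ a, hγU a ha⟩ with hδ
  have hδval : ∀ t ∈ Icc a b, (δ t : 𝒟₁.carrier) = γ t := fun t ht ↦ by
    simp only [hδ, dif_pos (hγU t ht)]
  have hδev : ∀ t ∈ Icc a b, (Subtype.val ∘ δ) =ᶠ[𝓝 t] γ := fun t ht ↦ by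
    have hmem : γ ⁻¹' (𝔠.opens : Set 𝒟₁.carrier) ∈ 𝓝 t :=
      (hcont t ht).preimage_mem_nhds (𝔠.opens.2.mem_nhds (hγU t ht))
    filter_upwards [hmem] with t' ht'
    simp only [comp_apply, hδ, dif_pos (show γ t' ∈ 𝔠.opens from ht')]
  have hδt : (𝒟₁.metric.restrict PseudoRiemannianMetric.contMDiff_restrict_holds
      𝔠.opens).IsFutureTimelikeCurveOn
      (𝒟₁.timeOrientation.restrict PseudoRiemannianMetric.contMDiff_restrict_holds
        𝒟₁.timeOrientation.contMDiff_restrict_holds 𝔠.opens) δ (Icc a b) := by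
    rw [LorentzianMetric.isFutureTimelikeCurveOn_restrict_iff]
    intro t ht
    obtain ⟨hd, h1, h2⟩ := hγ t ht
    have hveq : velocity (𝓡 (n + 1)) (Subtype.val ∘ δ) t = velocity (𝓡 (n + 1)) γ t :=
      DFunLike.congr_fun (hδev t ht).mfderiv_eq (1 : ℝ)
    refine ⟨(hδev t ht).mdifferentiableAt_iff.2 hd, ?_, ?_⟩
    · change 𝒟₁.metric.val (δ t : 𝒟₁.carrier) (velocity (𝓡 (n + 1)) (Subtype.val ∘ δ) t)
        (velocity (𝓡 (n + 1)) (Subtype.val ∘ δ) t) < 0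
      rw [hveq, hδval t ht]
      exact h1
    · change (𝒟₁.metric.val (δ t : 𝒟₁.carrier) (velocity (𝓡 (n + 1)) (Subtype.val ∘ δ) t)
          (velocity (𝓡 (n + 1)) (Subtype.val ∘ δ) t) ≤ 0 ∧
          velocity (𝓡 (n + 1)) (Subtype.val ∘ δ) t ≠ 0) ∧
        𝒟₁.metric.val (δ t : 𝒟₁.carrier) (𝒟₁.timeOrientation.vectorField (δ t : 𝒟₁.carrier))
          (velocity (𝓡 (n + 1)) (Subtype.val ∘ δ) t) < 0
      rw [hveq, hδval t ht]
      exact h2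
  -- push forward along `ψ`
  have hmapd : MDifferentiable (𝓡 (n + 1)) (𝓡 (n + 1)) 𝔠.map :=
    𝔠.contMDiff_map.mdifferentiable (by simp)
  have hψδ : 𝒟₂.metric.IsFutureTimelikeCurveOn 𝒟₂.timeOrientation (𝔠.map ∘ δ) (Icc a b) :=
    LorentzianMetric.IsFutureTimelikeCurveOn.comp_isIsometricImmersion hmapd
      𝔠.preservesTimeOrientation 𝔠.isIsometricImmersion.2 hδt
  have hea : (𝔠.map ∘ δ) a = 𝔠.glue (γ a) := by
    rw [comp_apply, 𝔠.glue_apply (hγU a ha)]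
    congr 1
    exact Subtype.ext (hδval a ha)
  have heb : (𝔠.map ∘ δ) b = 𝔠.glue (γ b) := by
    rw [comp_apply, 𝔠.glue_apply (hγU b hb)]
    congr 1
    exact Subtype.ext (hδval b hb)
  exact ⟨𝔠.glue (γ a), rfl, 𝔠.map ∘ δ, a, b, hab, hψδ, hea, heb⟩

/-- **`ψ⁻¹` carries a timelike segment of `M₂` lying in `ψ(U)` to a timelike segment of `M₁`**:
if `γ : [a, b] → ψ(U) ⊆ M₂`, `a < b`, is a future timelike curve of `M₂`, then
`ψ⁻¹ (γ b) ∈ I⁺(ψ⁻¹ (γ a))` in `M₁` (`ψ⁻¹ = glue.symm` is a smooth isometry of `ψ(U)` onto `U`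
reflecting future-directedness). O'Neill 1983, Ch. 3, pp. 90–91 and Ch. 14, p. 402.
[cite: ONeillSemiRiemannian1983, Ch. 14, p. 402] -/
theorem mem_chronologicalFuture_glue_symm_of_curve {γ : ℝ → 𝒟₂.carrier} {a b : ℝ} (hab : a < b)
    (hγ : 𝒟₂.metric.IsFutureTimelikeCurveOn 𝒟₂.timeOrientation γ (Icc a b))
    (hγW : ∀ t ∈ Icc a b, γ t ∈ range 𝔠.map) :
    𝔠.glue.symm (γ b) ∈
      𝒟₁.metric.chronologicalFuture 𝒟₁.timeOrientation {𝔠.glue.symm (γ a)} := by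
  have hδ : 𝒟₁.metric.IsFutureTimelikeCurveOn 𝒟₁.timeOrientation (𝔠.glue.symm ∘ γ) (Icc a b) := by
    intro t ht
    obtain ⟨hd, h1, h2⟩ := hγ t ht
    have hsm : MDifferentiableAt (𝓡 (n + 1)) (𝓡 (n + 1)) 𝔠.glue.symm (γ t) :=
      (𝔠.contMDiffAt_glue_symm (hγW t ht)).mdifferentiableAt (by simp)
    have hdδ : MDifferentiableAt 𝓘(ℝ, ℝ) (𝓡 (n + 1)) (𝔠.glue.symm ∘ γ) t := hsm.comp t hd
    have hvel : velocity (𝓡 (n + 1)) (𝔠.glue.symm ∘ γ) t =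
        mfderiv (𝓡 (n + 1)) (𝓡 (n + 1)) 𝔠.glue.symm (γ t) (velocity (𝓡 (n + 1)) γ t) := by
      change mfderiv 𝓘(ℝ, ℝ) (𝓡 (n + 1)) (𝔠.glue.symm ∘ γ) t (1 : ℝ) = _
      rw [mfderiv_comp t hsm hd]
      rfl
    refine ⟨hdδ, ?_, ?_⟩
    · change 𝒟₁.metric.val (𝔠.glue.symm (γ t)) (velocity (𝓡 (n + 1)) (𝔠.glue.symm ∘ γ) t)
        (velocity (𝓡 (n + 1)) (𝔠.glue.symm ∘ γ) t) < 0
      rw [hvel, 𝔠.val_mfderiv_glue_symm' (hγW t ht)]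
      exact h1
    · change 𝒟₁.timeOrientation.IsFutureDirected (x := 𝔠.glue.symm (γ t))
        (velocity (𝓡 (n + 1)) (𝔠.glue.symm ∘ γ) t)
      rw [hvel]
      exact 𝔠.isFutureDirected_mfderiv_glue_symm (hγW t ht) h2
  exact ⟨𝔠.glue.symm (γ a), rfl, 𝔠.glue.symm ∘ γ, a, b, hab, hδ, rfl, rfl⟩

/-- **`ψ⁻¹` reflects the chronological relation between points of `U` along segments inside
`ψ(U)`**: if `x, y ∈ U` and a future timelike segment of `M₂` inside `ψ(U)` runs from `ψ x` to
`ψ y`, then `x ≪ y` in `M₁`. [cite: ONeillSemiRiemannian1983, Ch. 14, p. 402] -/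
theorem mem_chronologicalFuture_of_curve_in_range {γ : ℝ → 𝒟₂.carrier} {a b : ℝ} (hab : a < b)
    (hγ : 𝒟₂.metric.IsFutureTimelikeCurveOn 𝒟₂.timeOrientation γ (Icc a b))
    (hγW : ∀ t ∈ Icc a b, γ t ∈ range 𝔠.map) {x y : 𝒟₁.carrier} (hx : x ∈ 𝔠.opens)
    (hy : y ∈ 𝔠.opens) (hγa : γ a = 𝔠.glue x) (hγb : γ b = 𝔠.glue y) :
    y ∈ 𝒟₁.metric.chronologicalFuture 𝒟₁.timeOrientation {x} := by
  have h := 𝔠.mem_chronologicalFuture_glue_symm_of_curve hab hγ hγW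
  have hxa : 𝔠.glue.symm (γ a) = x := by
    rw [hγa]; exact 𝔠.glue.left_inv (by rw [glue_source]; exact hx)
  have hyb : 𝔠.glue.symm (γ b) = y := by
    rw [hγb]; exact 𝔠.glue.left_inv (by rw [glue_source]; exact hy)
  rwa [hxa, hyb] at h

/-! ### `ι₂(Φ N)` is a Cauchy hypersurface of `ψ(U)` -/

/-- **`ψ(U) ∩ ι₂(X) = ι₂(Φ N)`**: a point of `ψ(U)` on the data hypersurface of `M₂` lies on
`ι₂(Φ N) = ψ(ι₁ N)` (`coe_mem_range_embed_of_map_mem`), and conversely `ψ ∘ ι₁ = ι₂ ∘ Φ`.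
[cite: HawkingEllis1973CUP, §7.6, p. 250] -/
theorem range_map_inter_range_embed :
    range 𝔠.map ∩ range 𝒟₂.embed = range (𝒟₂.embed ∘ Φ) := by
  ext z
  constructor
  · rintro ⟨⟨y, rfl⟩, hz⟩
    obtain ⟨x, hx⟩ := 𝔠.coe_mem_range_embed_of_map_mem y hz
    refine ⟨x, ?_⟩
    rw [comp_apply, ← 𝔠.map_embedOpens x]
    congr 1
    exact Subtype.ext hx
  · rintro ⟨x, rfl⟩
    exact ⟨⟨𝒟₁.embedOpens 𝔠.opens 𝔠.embed_mem x, 𝔠.map_embedOpens x⟩, Φ x, rfl⟩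

/-- `ι₂(Φ N) ⊆ ψ(U)`. [cite: HawkingEllis1973CUP, §7.6, p. 250] -/
theorem range_embed_comp_subset_range_map : range (𝒟₂.embed ∘ Φ) ⊆ range 𝔠.map := by
  rintro _ ⟨x, rfl⟩
  exact ⟨𝒟₁.embedOpens 𝔠.opens 𝔠.embed_mem x, 𝔠.map_embedOpens x⟩

/-- In `ψ(U)`, the trace of `ι₂(X)` is the trace of `ι₂(Φ N)`. [cite: HawkingEllis1973CUP, §7.6, p. 250] -/
theorem preimage_range_embed_eq :
    (Subtype.val ⁻¹' range 𝒟₂.embed : Set 𝔠.rangeOpens) = Subtype.val ⁻¹' range (𝒟₂.embed ∘ Φ) := by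
  ext z
  constructor
  · intro hz
    have h : (z : 𝒟₂.carrier) ∈ range 𝔠.map ∩ range 𝒟₂.embed := ⟨z.2, hz⟩
    rwa [𝔠.range_map_inter_range_embed] at h
  · rintro ⟨x, hx⟩
    exact ⟨Φ x, hx⟩

/-- **`ι₂(Φ N)` is a Cauchy hypersurface of the open sub-spacetime `ψ(U)` of `M₂`.** An endless
timelike curve `γ'` of `(ψ(U), g₂|, τ₂|)` is carried by `ψ⁻¹` to a timelike curve `δ` of `U`,
endless in `U` (an endpoint `q` of `δ` would make `ψ q ∈ ψ(U)` an endpoint of `γ'`); so `δ` meets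
the Cauchy hypersurface `ι₁(N)` of `U` exactly once, and `ψ` matches the crossings since
`ψ ∘ ι₁ = ι₂ ∘ Φ` and `ψ` is injective (relative form of Sbierski 2016, §2, Remark 3 (2)).
[cite: Sbierski2016AHP, §2, Remark 3 (2) and §3.1 Lemma 9 (arXiv numbering)] -/
theorem isCauchyHypersurface_rangeOpens :
    (𝒟₂.metric.restrict PseudoRiemannianMetric.contMDiff_restrict_holds 𝔠.rangeOpens).IsCauchyHypersurface
      (𝒟₂.timeOrientation.restrict PseudoRiemannianMetric.contMDiff_restrict_holds
        𝒟₂.timeOrientation.contMDiff_restrict_holds 𝔠.rangeOpens)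
      (Subtype.val ⁻¹' range (𝒟₂.embed ∘ Φ)) := by
  intro γ' s hγ'
  obtain ⟨hs, hγt, hγf, hγp⟩ := hγ'
  have hκ : 𝒟₂.metric.IsFutureTimelikeCurveOn 𝒟₂.timeOrientation (Subtype.val ∘ γ') s :=
    (LorentzianMetric.isFutureTimelikeCurveOn_restrict_iff _ _ _ _ _).1 hγt
  -- the lift `δ = ψ⁻¹ ∘ γ'`, a curve of `U`
  set δ : ℝ → 𝔠.opens := fun t ↦ ⟨𝔠.glue.symm (γ' t).1, 𝔠.glue_symm_mem_opens (γ' t).2⟩ with hδ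
  have hmapδ : ∀ t, 𝔠.map (δ t) = (γ' t).1 := fun t ↦ 𝔠.map_glue_symm (γ' t).2
  have hδval : (Subtype.val ∘ δ) = 𝔠.glue.symm ∘ (Subtype.val ∘ γ') := rfl
  -- `δ` is a future timelike curve of `M₁`
  have hδM : 𝒟₁.metric.IsFutureTimelikeCurveOn 𝒟₁.timeOrientation (Subtype.val ∘ δ) s := by
    intro t ht
    obtain ⟨hd, h1, h2⟩ := hκ t ht
    have hsm : MDifferentiableAt (𝓡 (n + 1)) (𝓡 (n + 1)) 𝔠.glue.symm ((Subtype.val ∘ γ') t) :=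
      (𝔠.contMDiffAt_glue_symm (γ' t).2).mdifferentiableAt (by simp)
    have hdδ : MDifferentiableAt 𝓘(ℝ, ℝ) (𝓡 (n + 1)) (Subtype.val ∘ δ) t := by
      rw [hδval]
      exact hsm.comp t hd
    have hvel : velocity (𝓡 (n + 1)) (Subtype.val ∘ δ) t =
        mfderiv (𝓡 (n + 1)) (𝓡 (n + 1)) 𝔠.glue.symm (γ' t).1
          (velocity (𝓡 (n + 1)) (Subtype.val ∘ γ') t) := by
      change mfderiv 𝓘(ℝ, ℝ) (𝓡 (n + 1)) (𝔠.glue.symm ∘ (Subtype.val ∘ γ')) t (1 : ℝ) = _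
      rw [mfderiv_comp t hsm hd]
      rfl
    refine ⟨hdδ, ?_, ?_⟩
    · change 𝒟₁.metric.val (𝔠.glue.symm (γ' t).1) (velocity (𝓡 (n + 1)) (Subtype.val ∘ δ) t)
        (velocity (𝓡 (n + 1)) (Subtype.val ∘ δ) t) < 0
      rw [hvel, 𝔠.val_mfderiv_glue_symm' (γ' t).2]
      exact h1
    · change 𝒟₁.timeOrientation.IsFutureDirected (x := 𝔠.glue.symm (γ' t).1)
        (velocity (𝓡 (n + 1)) (Subtype.val ∘ δ) t)
      rw [hvel]
      exact 𝔠.isFutureDirected_mfderiv_glue_symm (γ' t).2 h2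
  have hδU : (𝒟₁.metric.restrict PseudoRiemannianMetric.contMDiff_restrict_holds 𝔠.opens).IsFutureTimelikeCurveOn
      (𝒟₁.timeOrientation.restrict PseudoRiemannianMetric.contMDiff_restrict_holds
        𝒟₁.timeOrientation.contMDiff_restrict_holds 𝔠.opens) δ s :=
    (LorentzianMetric.isFutureTimelikeCurveOn_restrict_iff _ _ _ _ _).2 hδM
  -- `δ` is endless in `U`
  have hδf : IsFutureEndless δ s := by
    refine ⟨hγf.1, fun q hq ↦ ?_⟩
    have h1 : HasFutureEndpoint (𝔠.map ∘ δ) s (𝔠.map q) := (𝔠.contMDiff_map.continuous.tendsto q).comp hq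
    have h2 : HasFutureEndpoint (Subtype.val ∘ γ') s (𝔠.map q) := h1.congr fun t ↦ hmapδ t
    exact hγf.2 ⟨𝔠.map q, q, rfl⟩ (hasFutureEndpoint_subtypeVal_comp_iff.1 h2)
  have hδp : IsPastEndless δ s := by
    refine ⟨hγp.1, fun q hq ↦ ?_⟩
    have h1 : HasPastEndpoint (𝔠.map ∘ δ) s (𝔠.map q) := (𝔠.contMDiff_map.continuous.tendsto q).comp hq
    have h2 : HasPastEndpoint (Subtype.val ∘ γ') s (𝔠.map q) := h1.congr fun t ↦ hmapδ t
    exact hγp.2 ⟨𝔠.map q, q, rfl⟩ (hasPastEndpoint_subtypeVal_comp_iff.1 h2)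
  -- it meets `ι₁(N)` exactly once
  obtain ⟨t₀, ⟨ht₀s, ht₀S⟩, huniq⟩ := 𝔠.isCauchyHypersurface δ s ⟨hs, hδU, hδf, hδp⟩
  refine ⟨t₀, ⟨ht₀s, ?_⟩, fun t ht ↦ huniq t ⟨ht.1, ?_⟩⟩
  · -- `γ' t₀ = ψ (δ t₀) = ψ (ι₁ x) = ι₂ (Φ x)`
    obtain ⟨x, hx⟩ := ht₀S
    have hδx : δ t₀ = 𝒟₁.embedOpens 𝔠.opens 𝔠.embed_mem x := Subtype.ext hx.symm
    show (γ' t₀).1 ∈ range (𝒟₂.embed ∘ Φ)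
    rw [← hmapδ t₀, hδx, 𝔠.map_embedOpens]
    exact ⟨x, rfl⟩
  · -- `γ' t = ι₂ (Φ x) = ψ (ι₁ x)`, so `δ t = ι₁ x`
    obtain ⟨x, hx⟩ := ht.2
    show (δ t).1 ∈ range 𝒟₁.embed
    refine ⟨x, ?_⟩
    change 𝒟₁.embed x = 𝔠.glue.symm (γ' t).1
    rw [← hx, comp_apply, ← 𝔠.map_embedOpens x, 𝔠.glue_symm_apply_map]
    rfl

/-- **`ψ(U) ∩ ι₂(X)` is a Cauchy hypersurface of `ψ(U)`** — `isCauchyHypersurface_rangeOpens` in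
the shape `Subtype.val ⁻¹' ι₂(X)` of the hypothesis `hU` of the lemmas of
`SubdevelopmentTimelikeEntry` / `SubdevelopmentCausalConvexity` (with the ambient achronal set
`S = ι₂(X)`, the Cauchy hypersurface of `M₂`). [cite: HawkingEllis1973CUP, §7.6, p. 250] -/
theorem isCauchyHypersurface_rangeOpens' :
    (𝒟₂.metric.restrict PseudoRiemannianMetric.contMDiff_restrict_holds 𝔠.rangeOpens).IsCauchyHypersurface
      (𝒟₂.timeOrientation.restrict PseudoRiemannianMetric.contMDiff_restrict_holds
        𝒟₂.timeOrientation.contMDiff_restrict_holds 𝔠.rangeOpens)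
      (Subtype.val ⁻¹' range 𝒟₂.embed) := by
  rw [𝔠.preimage_range_embed_eq]
  exact 𝔠.isCauchyHypersurface_rangeOpens

/-! ### `ψ(U)` avoids the timelike shadow of `ι₂(X) ∖ ι₂(Φ N)` -/

/-- **No point of `ψ(U)` lies in `I⁺(ι₂(X) ∖ ι₂(Φ N))`**: if `k ≪ z` with `z ∈ ψ(U)` and
`k ∈ ι₂(X)`, then `k ∈ ψ(U)` (no timelike entry into `ψ(U)` from `J⁺(ι₂ X) ∖ ψ(U)`,
`IsAchronal.mem_opens_of_mem_chronologicalFuture`), hence `k ∈ ψ(U) ∩ ι₂(X) = ι₂(Φ N)`.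
Hawking–Ellis 1973, §6.5 (`D⁺(S) ∩ I⁺(edge)`); this is the first step of "the image of a
relative common development lies in the domain of dependence of `ι₂(Φ N)`".
[cite: HawkingEllis1973CUP, §6.5] -/
theorem not_mem_chronologicalFuture_diff_of_mem_range {z : 𝒟₂.carrier} (hz : z ∈ range 𝔠.map) :
    z ∉ 𝒟₂.metric.chronologicalFuture 𝒟₂.timeOrientation
      (range 𝒟₂.embed \ range (𝒟₂.embed ∘ Φ)) := by
  intro h
  have hn2 : (2 : ℕ∞ω) ≤ ∞ := WithTop.coe_le_coe.mpr le_top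
  rw [LorentzianMetric.chronologicalFuture_eq_biUnion] at h
  simp only [mem_iUnion, exists_prop] at h
  obtain ⟨k, ⟨hkS, hkS₀⟩, hkz⟩ := h
  have hA : 𝒟₂.metric.IsAchronal 𝒟₂.timeOrientation (range 𝒟₂.embed) :=
    LorentzianMetric.IsCauchyHypersurface.isAchronal_holds hn2 𝒟₂.isCauchyHypersurface
  have hk : k ∈ 𝔠.rangeOpens :=
    hA.mem_opens_of_mem_chronologicalFuture hn2 _ _ 𝔠.isCauchyHypersurface_rangeOpens'
      (LorentzianMetric.subset_causalFuture _ _ _ hkS) hz hkz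
  have hk' : k ∈ range 𝔠.map ∩ range 𝒟₂.embed := ⟨hk, hkS⟩
  rw [𝔠.range_map_inter_range_embed] at hk'
  exact hkS₀ hk'

/-- **No point of `ψ(U)` lies in `I⁻(ι₂(X) ∖ ι₂(Φ N))`** (time dual, through
`IsAchronal.mem_opens_of_mem_causalPast_of_mem_chronologicalFuture`). [cite: HawkingEllis1973CUP, §6.5] -/
theorem not_mem_chronologicalPast_diff_of_mem_range {z : 𝒟₂.carrier} (hz : z ∈ range 𝔠.map) :
    z ∉ 𝒟₂.metric.chronologicalPast 𝒟₂.timeOrientation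
      (range 𝒟₂.embed \ range (𝒟₂.embed ∘ Φ)) := by
  intro h
  have hn2 : (2 : ℕ∞ω) ≤ ∞ := WithTop.coe_le_coe.mpr le_top
  rw [LorentzianMetric.chronologicalPast, LorentzianMetric.chronologicalFuture_eq_biUnion] at h
  simp only [mem_iUnion, exists_prop] at h
  obtain ⟨k, ⟨hkS, hkS₀⟩, hkz⟩ := h
  have hA : 𝒟₂.metric.IsAchronal 𝒟₂.timeOrientation (range 𝒟₂.embed) :=
    LorentzianMetric.IsCauchyHypersurface.isAchronal_holds hn2 𝒟₂.isCauchyHypersurface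
  have hk : k ∈ 𝔠.rangeOpens :=
    hA.mem_opens_of_mem_causalPast_of_mem_chronologicalFuture hn2 _ _
      𝔠.isCauchyHypersurface_rangeOpens' (LorentzianMetric.subset_causalPast _ _ _ hkS) hz
      (LorentzianMetric.mem_chronologicalFuture_of_mem_chronologicalPast hkz)
  have hk' : k ∈ range 𝔠.map ∩ range 𝒟₂.embed := ⟨hk, hkS⟩
  rw [𝔠.range_map_inter_range_embed] at hk'
  exact hkS₀ hk'

/-- **`ψ(U)` is disjoint from `F = I⁺(K) ∪ I⁻(K) ∪ K`, `K = ι₂(X) ∖ ι₂(Φ N)`** — the set whose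
complement's closure-complement is the Cauchy piece domain of `ι₂(Φ N)` (`CauchyPieceDomain`).
[cite: HawkingEllis1973CUP, §6.5] -/
theorem disjoint_range_map_badSet :
    Disjoint (range 𝔠.map)
      (𝒟₂.metric.chronologicalFuture 𝒟₂.timeOrientation (range 𝒟₂.embed \ range (𝒟₂.embed ∘ Φ)) ∪
        𝒟₂.metric.chronologicalPast 𝒟₂.timeOrientation (range 𝒟₂.embed \ range (𝒟₂.embed ∘ Φ)) ∪
        (range 𝒟₂.embed \ range (𝒟₂.embed ∘ Φ))) := by
  rw [Set.disjoint_left]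
  rintro z hz ((h | h) | h)
  · exact 𝔠.not_mem_chronologicalFuture_diff_of_mem_range hz h
  · exact 𝔠.not_mem_chronologicalPast_diff_of_mem_range hz h
  · have hz' : z ∈ range 𝔠.map ∩ range 𝒟₂.embed := ⟨hz, h.1⟩
    rw [𝔠.range_map_inter_range_embed] at hz'
    exact h.2 hz'

/-- **`ψ(U)` does not meet the closure of `F`** either (`ψ(U)` is open). [cite: HawkingEllis1973CUP, §6.5] -/
theorem disjoint_range_map_closure_badSet :
    Disjoint (range 𝔠.map)
      (closure (𝒟₂.metric.chronologicalFuture 𝒟₂.timeOrientation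
          (range 𝒟₂.embed \ range (𝒟₂.embed ∘ Φ)) ∪
        𝒟₂.metric.chronologicalPast 𝒟₂.timeOrientation (range 𝒟₂.embed \ range (𝒟₂.embed ∘ Φ)) ∪
        (range 𝒟₂.embed \ range (𝒟₂.embed ∘ Φ)))) :=
  𝔠.disjoint_range_map_badSet.closure_right 𝔠.isOpenEmbedding_map.isOpen_range

end CauchyDevelopment.RelCommonDevelopment

end Literature.Geometry.Lorentzian

end
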